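import Literature.Computability.Complexity.TVHardnessBlockBit
import HarnessLib

/-!
# The instance bit and the word of Trevisan–Vadhan's universal formula, emitted in polynomial time

Literature / complexity — fifth file of the `PSPACE`-hardness of Trevisan–Vadhan's `LTV`: from the code
of a closed prenex QBF (quantifier string `qs`, unary size, prefix code of the matrix) the emitter
computes, for every variable `u` of the universal formula of size `n` (layout `QBFUniv.lay`:
`y_{jk} ↦ k + nj`, `z_{jk} ↦ n² + k + nj`, `x_k ↦ 2n² + k`, `s_k ↦ 2n² + n + k`), the bit of TV07's
instance description `QBFUniv.instOf n qs' C` for the padded pre-order Tseitin CNF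
`C = PreTseitin.cnfP3 φ V` (`TVHardnessTokens.lean`) — `y/z`: the membership bit of
`TVHardnessBlockBit.lean` below `3·size`, the root clause `(V)` at `3·size`, `[k = 0]` on the padding
clauses; `x`: `0`; `s`: the quantifier — and concatenates the blocks `bit :: 0^{Mof n}` into the point
bits of the Boolean point `ubv (instOf …)`:

* `TVHard.wRec` (the context `⟨c, ⟨qs, ⟨1^V, ⟨1^{size}, ⟨1ⁿ, 0^{Mof n}⟩⟩⟩⟩⟩`) and its accessors;
* **`TVHard.ubit`** with **`ubit_apply`**: on `⟨wRec, 1^{lay n u}⟩` its value is `[instOf n qs' C u]`;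
* **`TVHard.ptBitsF`** with **`ptBitsF_apply`**: the point bits `ptBits n (ubv (instOf n qs' C))`.

Everything is proved; no named fact is introduced (D-0026).

## References

* L. Trevisan, S. Vadhan, Comput. Complexity 16 (2007), §4, (4.2), Lemma 4.1 (ii), Thm. 4.3 (proof)
  [TrevisanVadhan2007].
* S. Arora, B. Barak, CUP 2009, §1.3 (bounded loops) [AroraBarakCC2009].
-/

noncomputable section

namespace Literature.Computability.Complexity

namespace TVHard

open _root_.Computability Polynomial Brick Plumb PreTseitin TVChk QBFUniv SelfCorrect
  Literature.Barriers.QuantumAdvantage Literature.Barriers.QuantumAdvantage.TQBFRed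

/-! ### The context record -/

/-- The context `⟨c, ⟨qs, ⟨1^V, ⟨1^U, ⟨1ⁿ, Z⟩⟩⟩⟩⟩`. [folklore] -/
def wRec (c qs : List Bool) (V U n : ℕ) (Z : List Bool) : List Bool :=
  boolPair c (boolPair qs (boolPair (ones V) (boolPair (ones U) (boolPair (ones n) Z))))

/-- `c`. [folklore] -/
def wC : List Bool → List Bool := fstF
/-- `qs`. [folklore] -/
def wQ : List Bool → List Bool := fstF ∘ sndF
/-- `1^V`. [folklore] -/
def wV : List Bool → List Bool := fstF ∘ sndF ∘ sndF
/-- `1^U`. [folklore] -/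
def wU : List Bool → List Bool := fstF ∘ sndF ∘ sndF ∘ sndF
/-- `1ⁿ`. [folklore] -/
def wN : List Bool → List Bool := fstF ∘ sndF ∘ sndF ∘ sndF ∘ sndF
/-- `Z`. [folklore] -/
def wZ : List Bool → List Bool := sndF ∘ sndF ∘ sndF ∘ sndF ∘ sndF

/-- Values of the accessors. [folklore] -/
theorem w_apply (c qs : List Bool) (V U n : ℕ) (Z : List Bool) :
    wC (wRec c qs V U n Z) = c ∧ wQ (wRec c qs V U n Z) = qs ∧ wV (wRec c qs V U n Z) = ones V ∧ wU (wRec c qs V U n Z) = ones U ∧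
    wN (wRec c qs V U n Z) = ones n ∧ wZ (wRec c qs V U n Z) = Z := by
  simp [wC, wQ, wV, wU, wN, wZ, wRec]

/-- The accessors are in `FP`. [folklore] -/
theorem w_mem_FP : wC ∈ FP ∧ wQ ∈ FP ∧ wV ∈ FP ∧ wU ∈ FP ∧ wN ∈ FP ∧ wZ ∈ FP := by
  refine ⟨fstF_mem_FP, comp_mem_FP fstF_mem_FP sndF_mem_FP, comp_mem_FP fstF_mem_FP (comp_mem_FP sndF_mem_FP sndF_mem_FP),
    comp_mem_FP fstF_mem_FP (comp_mem_FP sndF_mem_FP (comp_mem_FP sndF_mem_FP sndF_mem_FP)),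
    comp_mem_FP fstF_mem_FP (comp_mem_FP sndF_mem_FP (comp_mem_FP sndF_mem_FP (comp_mem_FP sndF_mem_FP sndF_mem_FP))),
    comp_mem_FP sndF_mem_FP (comp_mem_FP sndF_mem_FP (comp_mem_FP sndF_mem_FP (comp_mem_FP sndF_mem_FP sndF_mem_FP)))⟩

/-! ### The instance bit -/

/-- On the piece argument `⟨w, 1ᵛ⟩`: `1ⁿ`. [folklore] -/
def pN : List Bool → List Bool := wN ∘ fstF
/-- `⟨1^{v / n}, 1^{v % n}⟩`. [folklore] -/
def pDM : List Bool → List Bool := udivmodF ∘ fanoutFn sndF pN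
/-- `1^{v / n}`. [folklore] -/
def pQ : List Bool → List Bool := fstF ∘ pDM
/-- `1ᵏ = 1^{v % n}`. [folklore] -/
def pK : List Bool → List Bool := sndF ∘ pDM
/-- `[v / n < n]` (a `y` variable). [folklore] -/
def isY : List Bool → List Bool := ltLenF ∘ fanoutFn pQ pN
/-- `1^{2n}`. [folklore] -/
def pN2 : List Bool → List Bool := appF ∘ fanoutFn pN pN
/-- `[v / n < 2n]` (a `y` or `z` variable). [folklore] -/
def isYZ : List Bool → List Bool := ltLenF ∘ fanoutFn pQ pN2
/-- `[v / n = 2n]` (an `x` variable). [folklore] -/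
def isXv : List Bool → List Bool := eqPairFn ∘ fanoutFn pQ pN2
/-- The clause index `1ʲ`: `v / n` for `y`, `v / n − n` for `z`. [folklore] -/
def pJ : List Bool → List Bool := iteFn isY pQ (dropFn ∘ fanoutFn pN pQ)
/-- `1^{3U}`. [folklore] -/
def pU3 : List Bool → List Bool := appF ∘ fanoutFn (wU ∘ fstF) (appF ∘ fanoutFn (wU ∘ fstF) (wU ∘ fstF))
/-- `[j < 3U]` (a gate clause). [folklore] -/
def inBlk : List Bool → List Bool := ltLenF ∘ fanoutFn pJ pU3
/-- `[j = 3U]` (the root clause). [folklore] -/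
def isRoot : List Bool → List Bool := eqPairFn ∘ fanoutFn pJ pU3
/-- `⟨1^{j / 3}, 1^{j % 3}⟩`. [folklore] -/
def pTS : List Bool → List Bool := udivmodF ∘ fanoutFn pJ (fun _ => ones 3)
/-- The query record of the membership bit. [folklore] -/
def pQuery : List Bool → List Bool :=
  fanoutFn (wC ∘ fstF) (fanoutFn (wV ∘ fstF) (fanoutFn (fstF ∘ pTS) (fanoutFn (sndF ∘ pTS) (fanoutFn pK isY))))
/-- The root clause `(V)`: `[pol = 1 ∧ k = V]`. [folklore] -/
def rootBit : List Bool → List Bool := andFn isY (eqPairFn ∘ fanoutFn (wV ∘ fstF) pK)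
/-- The padding clauses `(x₀ ∨ ¬x₀)`: `[k = 0]`. [folklore] -/
def padBit : List Bool → List Bool := isNilFn ∘ pK
/-- The bit of a `y`/`z` variable. [cite: TrevisanVadhan2007, §4 (4.2)] -/
def yzBit : List Bool → List Bool := iteFn inBlk (blockBit ∘ pQuery) (iteFn isRoot rootBit padBit)
/-- `qs ⇂ k`. [folklore] -/
def sDrop : List Bool → List Bool := dropFn ∘ fanoutFn pK (wQ ∘ fstF)
/-- The bit of a selector variable: `qs_k` (`0` past the end): the head bit of `qs ⇂ k`. [cite: TrevisanVadhan2007, §4 (4.1)] -/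
def sBit : List Bool → List Bool := iteFn (isNilFn ∘ sDrop) (fun _ => [false]) (take1Fn ∘ sDrop)
/-- **The instance bit** of the variable at layout position `v`. [cite: TrevisanVadhan2007, §4 (4.2), Lemma 4.1 (ii)] -/
def ubit : List Bool → List Bool := iteFn isYZ yzBit (iteFn isXv (fun _ => [false]) sBit)

/-- These are in `FP`. [folklore] -/
theorem ubit_mem_FP : ubit ∈ FP := by
  obtain ⟨hC, hQ, hV, hU, hN, -⟩ := w_mem_FP
  have hpN : pN ∈ FP := comp_mem_FP hN fstF_mem_FP
  have hDM : pDM ∈ FP := comp_mem_FP udivmodF_mem_FP (fanoutFn_mem_FP sndF_mem_FP hpN)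
  have hpQ : pQ ∈ FP := comp_mem_FP fstF_mem_FP hDM
  have hpK : pK ∈ FP := comp_mem_FP sndF_mem_FP hDM
  have hY : isY ∈ FP := comp_mem_FP ltLenF_mem_FP (fanoutFn_mem_FP hpQ hpN)
  have hN2 : pN2 ∈ FP := comp_mem_FP appF_mem_FP (fanoutFn_mem_FP hpN hpN)
  have hYZ : isYZ ∈ FP := comp_mem_FP ltLenF_mem_FP (fanoutFn_mem_FP hpQ hN2)
  have hXv : isXv ∈ FP := comp_mem_FP eqPairFn_mem_FP (fanoutFn_mem_FP hpQ hN2)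
  have hJ : pJ ∈ FP := iteFn_mem_FP hY hpQ (comp_mem_FP dropFn_mem_FP (fanoutFn_mem_FP hpN hpQ))
  have hUf : (wU ∘ fstF) ∈ FP := comp_mem_FP hU fstF_mem_FP
  have hU3 : pU3 ∈ FP := comp_mem_FP appF_mem_FP (fanoutFn_mem_FP hUf (comp_mem_FP appF_mem_FP (fanoutFn_mem_FP hUf hUf)))
  have hin : inBlk ∈ FP := comp_mem_FP ltLenF_mem_FP (fanoutFn_mem_FP hJ hU3)
  have hroot : isRoot ∈ FP := comp_mem_FP eqPairFn_mem_FP (fanoutFn_mem_FP hJ hU3)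
  have hTS : pTS ∈ FP := comp_mem_FP udivmodF_mem_FP (fanoutFn_mem_FP hJ (const_mem_FP _))
  have hquery : pQuery ∈ FP := fanoutFn_mem_FP (comp_mem_FP hC fstF_mem_FP) (fanoutFn_mem_FP (comp_mem_FP hV fstF_mem_FP)
    (fanoutFn_mem_FP (comp_mem_FP fstF_mem_FP hTS) (fanoutFn_mem_FP (comp_mem_FP sndF_mem_FP hTS) (fanoutFn_mem_FP hpK hY))))
  have hrb : rootBit ∈ FP := andFn_mem_FP hY (comp_mem_FP eqPairFn_mem_FP (fanoutFn_mem_FP (comp_mem_FP hV fstF_mem_FP) hpK))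
  have hpad : padBit ∈ FP := comp_mem_FP isNilFn_mem_FP hpK
  have hyz : yzBit ∈ FP := iteFn_mem_FP hin (comp_mem_FP blockBit_mem_FP hquery) (iteFn_mem_FP hroot hrb hpad)
  have hsd : sDrop ∈ FP := comp_mem_FP dropFn_mem_FP (fanoutFn_mem_FP hpK (comp_mem_FP hQ fstF_mem_FP))
  have hs : sBit ∈ FP := iteFn_mem_FP (comp_mem_FP isNilFn_mem_FP hsd) (const_mem_FP _) (comp_mem_FP take1Fn_mem_FP hsd)
  exact iteFn_mem_FP hYZ hyz (iteFn_mem_FP hXv (const_mem_FP _) hs)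

/-! ### Value of the instance bit -/

/-- Reading past the end of the quantifier string gives `0`. [folklore] -/
theorem headI_drop (l : List Bool) (k : ℕ) : (l.drop k).headI = l.getD k false := by
  rw [List.getD_eq_getElem?_getD, ← List.head?_drop]
  cases l.drop k <;> rfl

/-- The padded quantifier string read at `k`. [folklore] -/
theorem getD_append_replicate (qs : List Bool) (U k : ℕ) : (qs ++ List.replicate U false).getD k false = qs.getD k false := by
  rw [List.getD_eq_getElem?_getD, List.getD_eq_getElem?_getD]
  by_cases hk : k < qs.length
  · rw [List.getElem?_append_left hk]
  · rw [List.getElem?_append_right (not_lt.1 hk), List.getElem?_eq_none (l := qs) (not_lt.1 hk)]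
    simp only [Option.getD_none]
    cases h : (List.replicate U false)[k - qs.length]? with
    | none => rfl
    | some b =>
      have := List.mem_of_getElem? h
      rw [List.mem_replicate] at this
      simp [this.2]

section Value

variable (φ : PropForm ℕ) (qs : List Bool) (V n : ℕ) (Z : List Bool) (hn : 1 ≤ n)

/-- The context of a formula. [folklore] -/
abbrev wOf : List Bool := wRec (tcode (toks φ)) qs V φ.size n Z

/-- Division data of the piece argument `⟨w, 1^{nq + r}⟩` (`r < n`). [folklore] -/
theorem piece_dm {q r : ℕ} (hr : r < n) :
    pN (boolPair (wOf φ qs V n Z) (ones (n * q + r))) = ones n ∧ pQ (boolPair (wOf φ qs V n Z) (ones (n * q + r))) = ones q ∧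
    pK (boolPair (wOf φ qs V n Z) (ones (n * q + r))) = ones r := by
  obtain ⟨-, -, -, -, hN, -⟩ := w_apply (tcode (toks φ)) qs V φ.size n Z
  have hpN : pN (boolPair (wOf φ qs V n Z) (ones (n * q + r))) = ones n := by rw [pN, Function.comp_apply, fstF_boolPair, hN]
  have hq : (n * q + r) / n = q := by rw [Nat.add_comm, Nat.add_mul_div_left _ _ (by omega), Nat.div_eq_of_lt hr, Nat.zero_add]
  have hr' : (n * q + r) % n = r := by rw [Nat.add_comm, Nat.add_mul_mod_self_left, Nat.mod_eq_of_lt hr]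
  have hdm : pDM (boolPair (wOf φ qs V n Z) (ones (n * q + r))) = boolPair (ones q) (ones r) := by
    rw [pDM, Function.comp_apply, fanoutFn_apply, sndF_boolPair, hpN, udivmodF_apply _ (by omega), hq, hr']
  exact ⟨hpN, by rw [pQ, Function.comp_apply, hdm, fstF_boolPair], by rw [pK, Function.comp_apply, hdm, sndF_boolPair]⟩

/-- The region tests of the piece argument. [folklore] -/
theorem piece_regions {q r : ℕ} (hr : r < n) :
    isY (boolPair (wOf φ qs V n Z) (ones (n * q + r))) = [decide (q < n)] ∧ isYZ (boolPair (wOf φ qs V n Z) (ones (n * q + r))) = [decide (q < 2 * n)] ∧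
    isXv (boolPair (wOf φ qs V n Z) (ones (n * q + r))) = [decide (q = 2 * n)] := by
  obtain ⟨hN, hQ, -⟩ := piece_dm φ qs V n Z (q := q) hr
  have h2 : pN2 (boolPair (wOf φ qs V n Z) (ones (n * q + r))) = ones (2 * n) := by
    rw [pN2, Function.comp_apply, fanoutFn_apply, hN, appF_boolPair, ones, ones, List.replicate_append_replicate, two_mul]
  refine ⟨?_, ?_, ?_⟩
  · rw [isY, Function.comp_apply, fanoutFn_apply, hQ, hN, ltLenF_boolPair]; simp [ones]
  · rw [isYZ, Function.comp_apply, fanoutFn_apply, hQ, h2, ltLenF_boolPair]; simp [ones]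
  · rw [isXv, Function.comp_apply, fanoutFn_apply, hQ, h2, eqPairFn_boolPair, decide_ones_eq']

/-- **The `y`/`z` bit is the instance description of the padded pre-order Tseitin CNF.**
[cite: TrevisanVadhan2007, §4 (4.2)] -/
theorem yzBit_apply {q r j : ℕ} (hr : r < n) (pol : Bool) (hq : q = (if pol then j else n + j)) (hj : j < n) :
    yzBit (boolPair (wOf φ qs V n Z) (ones (n * q + r))) =
      [if hj' : j < (cnfP3 φ V).length then decide (((r, pol) : Literal ℕ) ∈ (cnfP3 φ V)[j]) else decide (r = 0)] := by
  set p := boolPair (wOf φ qs V n Z) (ones (n * q + r)) with hp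
  obtain ⟨hN, hQ, hK⟩ := piece_dm φ qs V n Z (q := q) hr
  obtain ⟨hY, -, -⟩ := piece_regions φ qs V n Z (q := q) hr
  obtain ⟨hC, -, hV, hU, -, -⟩ := w_apply (tcode (toks φ)) qs V φ.size n Z
  have hYv : isY p = [pol] := by
    rw [hY, hq]; cases pol
    · simp
    · simp [hj]
  have hJ : pJ p = ones j := by
    rw [pJ, iteFn_apply hYv]
    cases pol
    · rw [if_neg Bool.false_ne_true, Function.comp_apply, fanoutFn_apply, hN, hQ, dropFn_boolPair, hq]
      simp [ones]
    · rw [if_pos rfl, hQ, hq, if_pos rfl]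
  have hU3 : pU3 p = ones (3 * φ.size) := by
    have hUf : (wU ∘ fstF) p = ones φ.size := by rw [Function.comp_apply, hp, fstF_boolPair, hU]
    rw [pU3, Function.comp_apply, fanoutFn_apply, hUf, Function.comp_apply, fanoutFn_apply, hUf, appF_boolPair, appF_boolPair, ones,
      List.replicate_append_replicate, List.replicate_append_replicate, ones, show φ.size + (φ.size + φ.size) = 3 * φ.size by ring]
  have hin : inBlk p = [decide (j < 3 * φ.size)] := by
    rw [inBlk, Function.comp_apply, fanoutFn_apply, hJ, hU3, ltLenF_boolPair, ones, ones, List.length_replicate, List.length_replicate]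
  have hroot : isRoot p = [decide (j = 3 * φ.size)] := by
    rw [isRoot, Function.comp_apply, fanoutFn_apply, hJ, hU3, eqPairFn_boolPair, decide_ones_eq']
  have hlen : (cnfP3 φ V).length = 3 * φ.size + 1 := length_cnfP3 φ V
  rw [yzBit, iteFn_apply hin]
  by_cases hjb : j < 3 * φ.size
  · -- a gate clause: the membership bit of the block at `j / 3`, slot `j % 3`
    rw [decide_eq_true hjb, if_pos rfl, Function.comp_apply]
    have hTS : pTS p = boolPair (ones (j / 3)) (ones (j % 3)) := by
      rw [pTS, Function.comp_apply, fanoutFn_apply, hJ, udivmodF_apply _ (by norm_num)]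
    have hquery : pQuery p = qRec (tcode (toks φ)) V (j / 3) (j % 3) r pol := by
      rw [pQuery, fanoutFn_apply, fanoutFn_apply, fanoutFn_apply, fanoutFn_apply, fanoutFn_apply, Function.comp_apply, hp, fstF_boolPair, hC,
        Function.comp_apply, fstF_boolPair, hV, ← hp, Function.comp_apply, hTS, fstF_boolPair, Function.comp_apply, hTS, sndF_boolPair, hK, hYv]
      rfl
    have ht : j / 3 < (toks φ).length := by rw [length_toks]; omega
    have hdrop : (toks φ).drop (j / 3) = (toks φ)[j / 3] :: (toks φ).drop (j / 3 + 1) := (List.drop_eq_getElem_cons ht)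
    -- clause `j` of the padded CNF is that slot of that block
    have hj3 : j < (gcl3 φ V).length := by rw [length_gcl3]; exact hjb
    have hblocks := gcl3_eq_blocks_toks φ V
    have hjb' : j < (blocks (toks φ) V 0 φ.size).length := by rw [← hblocks]; exact hj3
    have hcl : ∀ h0 : j < (cnfP3 φ V).length,
        (cnfP3 φ V)[j]'h0 = (blockAt (toks φ) V (j / 3))[j % 3]'(by rw [length_blockAt]; exact Nat.mod_lt _ (by norm_num)) := by
      intro h0
      rw [show (cnfP3 φ V)[j]'h0 = (gcl3 φ V)[j] from List.getElem_append_left hj3, List.getElem_of_eq hblocks hj3,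
        getElem_blocks (toks φ) V φ.size hjb' hjb (length_blockAt _ _)]
    rw [hquery, blockBit_apply (toks φ) ((toks φ).drop (j / 3 + 1)) ((toks φ)[j / 3]) hdrop (Nat.mod_lt _ (by norm_num)) r pol,
      dif_pos (by rw [hlen]; omega), hcl]
  · rw [decide_eq_false hjb, if_neg Bool.false_ne_true, iteFn_apply hroot]
    by_cases hjr : j = 3 * φ.size
    · -- the root clause `(V)`
      rw [decide_eq_true hjr, if_pos rfl, rootBit, andFn_apply hYv (by rw [Function.comp_apply, fanoutFn_apply, Function.comp_apply, hp,
        fstF_boolPair, hV, ← hp, hK, eqPairFn_boolPair]), dif_pos (by rw [hlen]; omega)]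
      have hcl : (cnfP3 φ V)[j]'(by rw [hlen]; omega) = [(V, true)] := by
        simp only [cnfP3, hjr]
        rw [List.getElem_append_right (by rw [length_gcl3])]
        simp [length_gcl3]
      rw [hcl]
      cases pol
      · simp
      · simp [eq_comm]
    · -- a padding clause
      rw [decide_eq_false hjr, if_neg Bool.false_ne_true, padBit, Function.comp_apply, hK, isNilFn, dif_neg (by rw [hlen]; omega)]
      simp [ones, List.replicate_eq_nil_iff]

/-- **Value of the instance bit**: at the layout position of `u`, the bit of TV07's instance description
of the padded pre-order Tseitin form. [cite: TrevisanVadhan2007, §4 (4.2), Lemma 4.1 (ii)] -/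
theorem ubit_apply (u : UVar n) :
    ubit (boolPair (wOf φ qs V n Z) (ones (lay n u).val)) =
      [instOf n (qs ++ List.replicate φ.size false) (cnfP3 φ V) u] := by
  cases u with
  | y j k =>
    have hv : (lay n (.y j k)).val = n * j.val + k.val := by rw [lay_y_val]; ring
    obtain ⟨-, hYZ, -⟩ := piece_regions φ qs V n Z (q := j.val) k.isLt
    rw [hv, ubit, iteFn_apply hYZ, decide_eq_true (by omega), if_pos rfl,
      yzBit_apply φ qs V n Z (q := j.val) k.isLt true (by simp) j.isLt, instOf]
  | z j k =>
    have hv : (lay n (.z j k)).val = n * (n + j.val) + k.val := by rw [lay_z_val]; ring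
    obtain ⟨-, hYZ, -⟩ := piece_regions φ qs V n Z (q := n + j.val) k.isLt
    have hj := j.isLt
    rw [hv, ubit, iteFn_apply hYZ, decide_eq_true (by omega), if_pos rfl,
      yzBit_apply φ qs V n Z (q := n + j.val) k.isLt false (by simp) j.isLt, instOf]
  | x k =>
    have hv : (lay n (.x k)).val = n * (2 * n) + k.val := by rw [lay_x_val]; ring
    obtain ⟨-, hYZ, hX⟩ := piece_regions φ qs V n Z (q := 2 * n) k.isLt
    rw [hv, ubit, iteFn_apply hYZ, decide_eq_false (lt_irrefl _), if_neg Bool.false_ne_true, iteFn_apply hX, decide_eq_true rfl, if_pos rfl, instOf]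
  | s k =>
    have hv : (lay n (.s k)).val = n * (2 * n + 1) + k.val := by rw [lay_s_val]; ring
    obtain ⟨-, hYZ, hX⟩ := piece_regions φ qs V n Z (q := 2 * n + 1) k.isLt
    obtain ⟨-, -, hK⟩ := piece_dm φ qs V n Z (q := 2 * n + 1) k.isLt
    obtain ⟨-, hQ, -, -, -, -⟩ := w_apply (tcode (toks φ)) qs V φ.size n Z
    have hsd : sDrop (boolPair (wOf φ qs V n Z) (ones (n * (2 * n + 1) + k.val))) = qs.drop k.val := by
      rw [sDrop, Function.comp_apply, fanoutFn_apply, hK, Function.comp_apply, fstF_boolPair, hQ, dropFn_boolPair, ones, List.length_replicate]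
    have hsb : sBit (boolPair (wOf φ qs V n Z) (ones (n * (2 * n + 1) + k.val))) = [qs.getD k.val false] := by
      have hc : (isNilFn ∘ sDrop) (boolPair (wOf φ qs V n Z) (ones (n * (2 * n + 1) + k.val))) = [decide (qs.drop k.val = [])] := by
        rw [Function.comp_apply, hsd, isNilFn]
      rw [sBit, iteFn_apply hc, ← headI_drop]
      cases hq : qs.drop k.val with
      | nil => simp
      | cons b rest => rw [decide_eq_false (by simp), if_neg Bool.false_ne_true, Function.comp_apply, hsd, hq]; rfl
    rw [hv, ubit, iteFn_apply hYZ, decide_eq_false (by omega), if_neg Bool.false_ne_true, iteFn_apply hX, decide_eq_false (by omega),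
      if_neg Bool.false_ne_true, hsb, instOf, getD_append_replicate]

end Value

/-! ### The point bits -/

/-- The piece of the word fold: the bit, then the zeros `Z` of the context. [folklore] -/
def pieceF : List Bool → List Bool := appF ∘ fanoutFn ubit (wZ ∘ fstF)

/-- `pieceF ∈ FP`. [folklore] -/
theorem pieceF_mem_FP : pieceF ∈ FP := comp_mem_FP appF_mem_FP (fanoutFn_mem_FP ubit_mem_FP (comp_mem_FP w_mem_FP.2.2.2.2.2 fstF_mem_FP))

/-- The round count `bin (N n)` from the context (`nSuccOf` gives `1^{N n + 1}`). [folklore] -/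
def nCount : List Bool → List Bool := lenBinF ∘ dropFn ∘ fanoutFn (fun _ => ones 1) (nSuccOf ∘ wN)

/-- Initialisation of the word fold: `⟨w, ⟨bin (N n), ⟨ε, ε⟩⟩⟩`. [folklore] -/
def wInit : List Bool → List Bool := fanoutFn (fun w => w) (fanoutFn nCount fun _ => boolPair [] [])

/-- **The point bits** of the Boolean point of the instance: the fold of the pieces over `v < N n`.
[cite: TrevisanVadhan2007, Thm. 4.3 (proof), Lemma 4.1 (ii)] -/
def ptBitsF : List Bool → List Bool := sndPow 2 ∘ foldLoop appF (clipF 1 pieceF) (2 * X ^ 2 + 2 * X) ∘ wInit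

/-- `ptBitsF ∈ FP`. [folklore] -/
theorem ptBitsF_mem_FP : ptBitsF ∈ FP :=
  comp_mem_FP (sndPow_mem_FP 2) (comp_mem_FP (foldLoop_clipF_mem_FP 1 appF_mem_FP length_appF_le pieceF_mem_FP _)
    (fanoutFn_mem_FP (PolyTimeComputable.id _) (fanoutFn_mem_FP (comp_mem_FP lenBinF_mem_FP (comp_mem_FP dropFn_mem_FP
      (fanoutFn_mem_FP (const_mem_FP _) (comp_mem_FP nSuccOf_mem_FP w_mem_FP.2.2.2.2.1)))) (const_mem_FP _))))

/-- The bits of a `0/1` field element, read at a position: the bit at `0`, zeros after. [folklore] -/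
theorem encF_bv_apply {m : ℕ} (M : ℕ) (b : Fin m → Bool) (v : Fin m) (l : Fin (M + 1)) :
    encF M (QBFArith.bv (R := Literature.InformationTheory.Coding.GF2 M) b v) l = (b v :: List.replicate M false).getD l.val false := by
  unfold QBFArith.bv
  by_cases hb : b v
  · simp only [hb, if_true, encF_one]
    rcases Nat.eq_zero_or_pos l.val with h0 | hpos
    · rw [h0]; simp
    · rw [decide_eq_false (by omega)]
      obtain ⟨j, hj⟩ : ∃ j, l.val = j + 1 := ⟨l.val - 1, by omega⟩
      rw [hj, List.getD_cons_succ, List.getD_eq_getElem?_getD]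
      have : j < M := by have := l.isLt; omega
      simp [this]
  · simp only [Bool.not_eq_true] at hb
    simp only [hb]
    rw [show (if false = true then (1 : Literature.InformationTheory.Coding.GF2 M) else 0) = 0 from rfl, encF_zero]
    rcases Nat.eq_zero_or_pos l.val with h0 | hpos
    · rw [h0]; simp
    · obtain ⟨j, hj⟩ : ∃ j, l.val = j + 1 := ⟨l.val - 1, by omega⟩
      rw [hj, List.getD_cons_succ, List.getD_eq_getElem?_getD]
      have : j < M := by have := l.isLt; omega
      simp [this]

/-- Reading inside block `v` of a concatenation of equal blocks. [folklore] -/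
theorem getD_ccat {g : ℕ → List Bool} {T k : ℕ} (hT : ∀ u < k, (g u).length = T) {v l : ℕ} (hv : v < k) (hl : l < T) :
    (ccat g k).getD (v * T + l) false = (g v).getD l false := by
  have hblk := blk_ccat (g := g) (T := T) (k := k) hT hv
  rw [HashBricks.blk] at hblk
  have h1 : (((ccat g k).drop (v * T)).take T).getD l false = (ccat g k).getD (v * T + l) false := by
    rw [List.getD_eq_getElem?_getD, List.getD_eq_getElem?_getD, List.getElem?_take_of_lt hl, List.getElem?_drop]
  rw [← h1, hblk]

section Word

variable (φ : PropForm ℕ) (qs : List Bool) (V n : ℕ)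

/-- The context has at least `n` symbols and at least `|Z|` symbols. [folklore] -/
theorem length_wOf_ge (Z : List Bool) : n ≤ (wOf φ qs V n Z).length ∧ Z.length ≤ (wOf φ qs V n Z).length := by
  simp only [wRec, length_boolPair, ones, List.length_replicate]
  constructor <;> omega

/-- **Value of `ptBitsF`**: on the context with `Z = 0^{Mof n}`, the point bits of the Boolean point
`ubv (instOf n qs' (cnfP3 φ V))`. [cite: TrevisanVadhan2007, Thm. 4.3 (proof), Lemma 4.1 (ii)] -/
theorem ptBitsF_apply :
    ptBitsF (wOf φ qs V n (List.replicate (Mof n) false)) =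
      ptBits n (ubv (instOf n (qs ++ List.replicate φ.size false) (cnfP3 φ V))) := by
  obtain ⟨-, -, -, -, hN, hZ⟩ := w_apply (tcode (toks φ)) qs V φ.size n (List.replicate (Mof n) false)
  obtain ⟨hlenW, hlenZ⟩ := length_wOf_ge φ qs V n (List.replicate (Mof n) false)
  rw [List.length_replicate] at hlenZ
  have hpiece : ∀ v : Fin (N n), pieceF (boolPair (wOf φ qs V n (List.replicate (Mof n) false)) (ones v.val)) =
      instOf n (qs ++ List.replicate φ.size false) (cnfP3 φ V) ((lay n).symm v) :: List.replicate (Mof n) false := by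
    intro v
    have hu := ubit_apply φ qs V n (List.replicate (Mof n) false) ((lay n).symm v)
    rw [Equiv.apply_symm_apply] at hu
    rw [pieceF, Function.comp_apply, fanoutFn_apply, hu, Function.comp_apply, fstF_boolPair, hZ, appF_boolPair]
    rfl
  have hk : N n ≤ (2 * X ^ 2 + 2 * X : Polynomial ℕ).eval (wOf φ qs V n (List.replicate (Mof n) false)).length := by
    simp only [eval_add, eval_mul, eval_ofNat, eval_pow, eval_X]
    rw [N_eq]; nlinarith [hlenW]
  have hinit : wInit (wOf φ qs V n (List.replicate (Mof n) false)) =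
      boolPair (wOf φ qs V n (List.replicate (Mof n) false)) (boolPair (encodeNat (N n)) (boolPair (ones 0) [])) := by
    rw [wInit, fanoutFn_apply, fanoutFn_apply, nCount, Function.comp_apply, Function.comp_apply, fanoutFn_apply, Function.comp_apply, hN, nSuccOf_apply,
      dropFn_boolPair, lenBinF_apply]
    simp [ones]
  rw [ptBitsF, Function.comp_apply, Function.comp_apply, hinit, foldLoop_apply _ _ hk, sndPow_succ_boolPair, sndPow_succ_boolPair, sndPow_zero_boolPair,
    foldAcc_clipF (fun j _ hj => by
      have hj' : j < N n := by omega
      rw [hpiece ⟨j, hj'⟩, List.length_cons, List.length_replicate]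
      omega),
    foldAcc_appF, List.nil_append]
  simp only [Nat.zero_add]
  -- both sides are the concatenation of the blocks `b v :: 0^{Mof n}`: compare them position by position
  have hT : ∀ u < N n, (pieceF (boolPair (wOf φ qs V n (List.replicate (Mof n) false)) (ones u))).length = blk n := fun u hu => by
    rw [hpiece ⟨u, hu⟩, List.length_cons, List.length_replicate]
  have hlen1 : (ccat (fun j => pieceF (boolPair (wOf φ qs V n (List.replicate (Mof n) false)) (ones j))) (N n)).length = N n * blk n :=
    length_ccat_of_eq hT
  apply List.ext_getElem
  · rw [hlen1, length_ptBits, ptLen]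
  · intro i h1 h2
    rw [hlen1] at h1
    have hbp := blk_pos n
    have hvN : i / blk n < N n := (Nat.div_lt_iff_lt_mul hbp).2 h1
    have hlB : i % blk n < blk n := Nat.mod_lt _ hbp
    have hi : i / blk n * blk n + i % blk n = i := Nat.div_add_mod' i (blk n)
    rw [← List.getD_eq_getElem _ false, ← List.getD_eq_getElem _ false, ← hi, getD_ccat hT hvN hlB,
      getD_ptBits n _ ⟨i / blk n, hvN⟩ ⟨i % blk n, hlB⟩, hpiece ⟨i / blk n, hvN⟩, ubv, encF_bv_apply]
    rfl

end Word

end TVHard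

end Literature.Computability.Complexity

end
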